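import Mathlib
import Literature.NumberTheory.LFunctions.Zhang2022.SkeletonPartThree
import Literature.NumberTheory.LFunctions.Zhang2022.TypedAppendixB
import Literature.NumberTheory.LFunctions.Zhang2022.SkeletonAlpha1

/-!
# Zhang (2022) Appendix B, proof of Lemma 15.1, `μ = 2`: the residue at `s = 0` evaluated —
# "`−β_j/(β₇² log P₂) = −8j/(25πi) + O(α₁)`" in the cell's `α₁ = α log T` reading, kernel-checked

Topic `Literature/NumberTheory/LFunctions/Zhang2022` (Landau–Siegel audit tree; verdict-neutral).
Y. Zhang, *Discrete mean estimates and the Landau–Siegel zero*, arXiv:2211.02515v1 (2022)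
[Zhang2022LandauSiegel] — **an unrefereed manuscript under adjudication; nothing in this file
asserts any claim of the manuscript beyond the displayed evaluation it PROVES.** Cell siegel-zhang
(D-0069), DISCHARGE row D16 (Lemma 15.1), DAG node `Z22:§B.u010` (second equality) [Z22 p.107,
tex L5300–5302]: "By direct calculation, the residue at `s = 0` is
`−β_j/(β₇² log P₂) = −8j/(25πi) + O(α₁)`", typed by L4-t10 as `Typed.AppendixB.StepB_u010b`
(`resZero2 c′ D j = −β_j/(β₇² log P₂)`) with `α₁` read as `α𝓛`.

What is PROVED here (`resZero2_sub_main_le`): for `j ∈ {1,2,3}`,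
`|−β_j/(β₇² log P₂) + 8j/(25πi)| ≤ C(c′)·α₁` with **`α₁ = α log T = α𝓛^{1.1}`** (the cell's ruling,
`Skeleton.alpha1`, `SkeletonAlpha1`), `C(c′) = (12/25)(20|c′| + 80/π)/π`. The computation: with
`β_j = jiα(1 + κ_jc′α𝓛)` (`κ = −5, 1, −1`, (2.13)), `β₇ = 5iα/2` ((2.22)), `log P₂ = 𝓛⁹/2 − 10𝓛^{1.1}`
((2.21): `P₂ = P^{1/2}T⁻¹⁰`, `T = e^{𝓛^{1.1}}`) and `α𝓛⁹ = π` ((2.10)), EXACTLY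
`−β_j/(β₇² log P₂) = (4ji/25)·(1 + κ_jc′α𝓛)/(α log P₂)` and `−8j/(25πi) = (4ji/25)·(2/π)`, so the
difference is `(4ji/25)·(κ_jc′α𝓛·𝓛⁹/2 + 10𝓛^{1.1})/(α log P₂ · 𝓛⁹/2)`, of modulus
`≤ (12/25)·(20|c′| + 80/π)·𝓛^{1.1}/𝓛⁹ / π⁻¹…` `= C(c′)·α𝓛^{1.1}`. REMARK (the finding of L4-t10, row
G-L4t10-2, now visible in the kernel constants): the `10𝓛^{1.1}` coming from `T⁻¹⁰` makes the error
genuinely of order `𝓛^{1.1}/𝓛⁹ = α𝓛^{1.1}/π`, NOT `O(α𝓛)`; the typed literal `StepB_u010b` (rate `α𝓛`)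
is therefore not what is proved here — the `α₁ = α log T` reading is.

Also PROVED: the BOOKKEEPING edge `stepB_mu2_rate_of` / `stepB_mu2_alpha1_of` — "These together complete
the proof in case `μ = 2`": `StepB_u009` (Perron, a tree theorem) + the contour shift `StepB_u009r`
+ the split of `∮_{|s|=5α}` into the circles at `0` and `β₇` + the two residues and their evaluations
⇒ `Σ_l ϰ₂(l₁l)ϱ_j(l)/l = e_{2j} + O(r)` (`StepB_mu2` at rate `r`; `e_{2j}` = the sum of the two main
values), with the residue-at-`0` evaluation discharged here for `r = α₁`.

WHAT THIS IS NOT: the residue computation itself (`StepB_u010a`), the `s = β₇` residue and its value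
(`StepB_u011a/b`), the contour shift (`StepB_u009r`), the two-circle decomposition, or Lemma 15.1;
no claim about Theorems 1–2 or Landau–Siegel zeros.

## References

* Y. Zhang, arXiv:2211.02515v1 (2022), App. B p. 107 (proof of Lemma 15.1, `μ = 2`); §2 (2.10),
  (2.13), (2.21), (2.22); §6 (`T`). [cite: Zhang2022LandauSiegel, App. B p.107]
-/

noncomputable section

open Complex Real

namespace Literature.NumberTheory.LFunctions.Zhang2022.Skeleton

open Typed.AppendixB (resZero2 resBeta2 intB2 vline vkSum)

section ResZero

variable (c' : ℝ)

/-- `β_j = j·iα·(1 + κ_j c′α𝓛)` for `j = 1, 2, 3` with `κ = −5, 1, −1` ((2.13)): the real factor.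
[cite: Zhang2022LandauSiegel, §2 (2.13)] -/
theorem betaJ_eq_of_mem (D : ℕ) {j : ℕ} (hj : j ∈ ({1, 2, 3} : Finset ℕ)) :
    ∃ κ : ℝ, |κ| ≤ 5 ∧ betaJ c' D j =
      (((j : ℝ) * alpha D * (1 + κ * c' * alpha D * ell D) : ℝ) : ℂ) * I := by
  simp only [Finset.mem_insert, Finset.mem_singleton] at hj
  rcases hj with rfl | rfl | rfl
  · refine ⟨-5, by norm_num, ?_⟩
    rw [betaJ]; simp only [Nat.one_mod, if_true, beta1]; push_cast; ring
  · refine ⟨1, by norm_num, ?_⟩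
    rw [betaJ]; simp only [Nat.reduceMod, if_true, beta2]; push_cast; ring
  · refine ⟨-1, by norm_num, ?_⟩
    rw [betaJ]; simp only [Nat.reduceMod, beta3]; push_cast; ring

/-- `log P₂ = 𝓛⁹/2 − 10𝓛^{1.1}` ((2.21) `P₂ = P^{1/2}T⁻¹⁰`, `P = e^{𝓛⁹}`, `T = e^{𝓛^{1.1}}`).
[cite: Zhang2022LandauSiegel, §2 (2.21)] -/
theorem log_P2 (D : ℕ) : Real.log (P2 D) = ell D ^ 9 / 2 - 10 * ell D ^ (1.1 : ℝ) := by
  have h1 : bigP D ^ (0.5 : ℝ) ≠ 0 := (Real.rpow_pos_of_pos (Real.exp_pos _) _).ne'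
  have h2 : bigT D ^ 10 ≠ 0 := (pow_pos (Real.exp_pos _) _).ne'
  have h3 : 0 < bigP D := Real.exp_pos _
  rw [P2, Real.log_div h1 h2, Real.log_rpow h3, Real.log_pow, bigP, bigT, Real.log_exp, Real.log_exp]
  push_cast
  ring

/-- **"`−β_j/(β₇² log P₂) = −8j/(25πi) + O(α₁)`" with `α₁ = α log T`** (App. B p. 107, `μ = 2`,
residue at `s = 0`; the `α₁ = α𝓛^{1.1}` reading of `Typed.AppendixB.StepB_u010b`): for `j ∈ {1,2,3}`
and `D` large, `‖resZero2 c′ D j − (−8j/(25πi))‖ ≤ (12/25)(20|c′| + 80/π)/π · α₁`. PROVED (exact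
algebra, see the module docstring). [cite: Zhang2022LandauSiegel, App. B p.107] -/
theorem resZero2_sub_main_le :
    ∃ C : ℝ, ForAllLarge fun D _ _ => ∀ j ∈ ({1, 2, 3} : Finset ℕ),
      ‖resZero2 c' D j - (-(8 * (j : ℂ) / (25 * π * I)))‖ ≤ C * alpha1 D := by
  refine ⟨12 / 25 * ((20 * |c'| + 80 / π) / π), 8, fun D _ χ hD hq hp j hj => ?_⟩
  -- sizes
  have hD8 : (8 : ℝ) ≤ D := by exact_mod_cast hD
  have hℓ2 : 2 ≤ ell D := by
    have he2 : Real.exp 2 ≤ 8 := by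
      have h : Real.exp 2 = Real.exp 1 * Real.exp 1 := by rw [← Real.exp_add]; norm_num
      rw [h]; nlinarith [Real.exp_one_lt_d9, Real.exp_pos 1]
    calc (2 : ℝ) = Real.log (Real.exp 2) := (Real.log_exp 2).symm
      _ ≤ Real.log 8 := Real.log_le_log (Real.exp_pos _) he2
      _ ≤ Real.log D := Real.log_le_log (by norm_num) hD8
  have hℓ1 : 1 ≤ ell D := by linarith
  have hℓ0 : 0 < ell D := by linarith
  set ℓ : ℝ := ell D with hℓ
  set a : ℝ := alpha D with ha
  have h9 : a * ℓ ^ 9 = π := by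
    rw [ha, alpha, bigP, Real.log_exp, ← hℓ, div_mul_cancel₀ _ (pow_ne_zero _ hℓ0.ne')]
  have ha0 : 0 < a := by
    rw [ha, alpha, bigP, Real.log_exp]; exact div_pos Real.pi_pos (pow_pos hℓ0 _)
  have haℓ : a * ℓ = π / ℓ ^ 8 := by
    rw [eq_div_iff (pow_ne_zero _ hℓ0.ne'), ← h9]; ring
  -- `ℓ^{1.1} ≤ ℓ²`, `ℓ ≤ ℓ^{1.1}`
  have h11 : ℓ ^ (1.1 : ℝ) ≤ ℓ ^ 2 := by
    calc ℓ ^ (1.1 : ℝ) ≤ ℓ ^ (2 : ℝ) := Real.rpow_le_rpow_of_exponent_le hℓ1 (by norm_num)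
      _ = ℓ ^ 2 := by norm_cast
  have h1l : ℓ ≤ ℓ ^ (1.1 : ℝ) := by
    calc ℓ = ℓ ^ (1 : ℝ) := (Real.rpow_one ℓ).symm
      _ ≤ ℓ ^ (1.1 : ℝ) := Real.rpow_le_rpow_of_exponent_le hℓ1 (by norm_num)
  have h11pos : 0 < ℓ ^ (1.1 : ℝ) := Real.rpow_pos_of_pos hℓ0 _
  -- `L = log P₂ = ℓ⁹/2 − 10 ℓ^{1.1} ≥ ℓ⁹/4 > 0`
  set L : ℝ := Real.log (P2 D) with hL
  have hLeq : L = ℓ ^ 9 / 2 - 10 * ℓ ^ (1.1 : ℝ) := by rw [hL, log_P2]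
  have hℓ7 : (128 : ℝ) ≤ ℓ ^ 7 := by
    calc (128 : ℝ) = 2 ^ 7 := by norm_num
      _ ≤ ℓ ^ 7 := by gcongr
  have hℓ9 : 128 * ℓ ^ 2 ≤ ℓ ^ 9 := by
    have : ℓ ^ 9 = ℓ ^ 2 * ℓ ^ 7 := by ring
    rw [this]; nlinarith [pow_pos hℓ0 2]
  have hL4 : ℓ ^ 9 / 4 ≤ L := by rw [hLeq]; nlinarith
  have hL0 : 0 < L := lt_of_lt_of_le (by positivity) hL4
  -- `β_j`, `β₇`
  obtain ⟨κ, hκ, hβ⟩ := betaJ_eq_of_mem c' D hj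
  set e : ℝ := κ * c' * a * ℓ with he
  have hβ7 : beta7 D = (((5 * a / 2 : ℝ)) : ℂ) * I := by rw [beta7, ← ha]; push_cast; ring
  -- the exact algebra
  have hI2 : (I : ℂ) ^ 2 = -1 := Complex.I_sq
  have ha' : (a : ℂ) ≠ 0 := by exact_mod_cast ha0.ne'
  have hL' : (L : ℂ) ≠ 0 := by exact_mod_cast hL0.ne'
  have hπ' : (π : ℂ) ≠ 0 := by exact_mod_cast Real.pi_ne_zero
  have key : resZero2 c' D j - (-(8 * (j : ℂ) / (25 * π * I))) =
      (((4 * j / 25) * ((1 + e) / (a * L) - 2 / π) : ℝ) : ℂ) * I := by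
    rw [resZero2, hβ, hβ7, ← hL, ← ha]
    push_cast
    field_simp
    rw [hI2]
    ring
  rw [key, norm_mul, Complex.norm_I, mul_one, Complex.norm_real, Real.norm_eq_abs]
  -- the real estimate
  have hj3 : (j : ℝ) ≤ 3 := by
    simp only [Finset.mem_insert, Finset.mem_singleton] at hj
    rcases hj with rfl | rfl | rfl <;> norm_num
  have hj0 : (0 : ℝ) ≤ j := Nat.cast_nonneg j
  have hfrac : (1 + e) / (a * L) - 2 / π =
      (e * (ℓ ^ 9 / 2) + 10 * ℓ ^ (1.1 : ℝ)) / (a * L * (ℓ ^ 9 / 2)) := by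
    have h2π : 2 / π = 1 / (a * (ℓ ^ 9 / 2)) := by
      rw [← h9]; field_simp
    have hℓ9ne : ℓ ^ 9 / 2 ≠ 0 := by positivity
    have step : (1 + e) / (a * L) - 1 / (a * (ℓ ^ 9 / 2)) =
        ((1 + e) * (ℓ ^ 9 / 2) - L) / (a * L * (ℓ ^ 9 / 2)) := by
      field_simp
      try ring
    rw [h2π, step, show (1 + e) * (ℓ ^ 9 / 2) - L = e * (ℓ ^ 9 / 2) + 10 * ℓ ^ (1.1 : ℝ) by
      rw [hLeq]; ring]
  have habs_e : |e| ≤ 5 * |c'| * (π / ℓ ^ 8) := by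
    rw [he, show κ * c' * a * ℓ = (κ * c') * (a * ℓ) by ring, abs_mul, abs_mul, haℓ,
      abs_of_pos (show (0 : ℝ) < π / ℓ ^ 8 by positivity)]
    gcongr
  have hnum : |e * (ℓ ^ 9 / 2) + 10 * ℓ ^ (1.1 : ℝ)| ≤ (5 / 2 * |c'| * π + 10) * ℓ ^ (1.1 : ℝ) := by
    calc |e * (ℓ ^ 9 / 2) + 10 * ℓ ^ (1.1 : ℝ)|
        ≤ |e * (ℓ ^ 9 / 2)| + |10 * ℓ ^ (1.1 : ℝ)| := abs_add_le _ _
      _ = |e| * (ℓ ^ 9 / 2) + 10 * ℓ ^ (1.1 : ℝ) := by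
          rw [abs_mul, abs_of_pos (by positivity : (0:ℝ) < ℓ ^ 9 / 2),
            abs_of_pos (by positivity : (0:ℝ) < 10 * ℓ ^ (1.1 : ℝ))]
      _ ≤ 5 * |c'| * (π / ℓ ^ 8) * (ℓ ^ 9 / 2) + 10 * ℓ ^ (1.1 : ℝ) := by gcongr
      _ = 5 / 2 * |c'| * π * ℓ + 10 * ℓ ^ (1.1 : ℝ) := by
          congr 1
          field_simp
          try ring
      _ ≤ 5 / 2 * |c'| * π * ℓ ^ (1.1 : ℝ) + 10 * ℓ ^ (1.1 : ℝ) := by gcongr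
      _ = (5 / 2 * |c'| * π + 10) * ℓ ^ (1.1 : ℝ) := by ring
  have hden : π * ℓ ^ 9 / 8 ≤ a * L * (ℓ ^ 9 / 2) := by
    calc π * ℓ ^ 9 / 8 = (a * ℓ ^ 9) * (ℓ ^ 9 / 4) / 2 := by rw [h9]; ring
      _ ≤ (a * ℓ ^ 9) * L / 2 := by gcongr
      _ = a * L * (ℓ ^ 9 / 2) := by ring
  have hden0 : 0 < a * L * (ℓ ^ 9 / 2) := by positivity
  have hα1 : alpha1 D = π * ℓ ^ (1.1 : ℝ) / ℓ ^ 9 := by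
    rw [alpha1, log_bigT, ← hℓ, ← ha, eq_div_iff (pow_ne_zero _ hℓ0.ne'), ← h9]; ring
  rw [hfrac, abs_mul, abs_of_nonneg (by positivity : (0:ℝ) ≤ 4 * j / 25), abs_div,
    abs_of_pos hden0]
  calc 4 * (j : ℝ) / 25 * (|e * (ℓ ^ 9 / 2) + 10 * ℓ ^ (1.1 : ℝ)| / (a * L * (ℓ ^ 9 / 2)))
      ≤ 4 * 3 / 25 * (((5 / 2 * |c'| * π + 10) * ℓ ^ (1.1 : ℝ)) / (π * ℓ ^ 9 / 8)) := by
        gcongr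
    _ = 12 / 25 * ((20 * |c'| + 80 / π) / π) * (π * ℓ ^ (1.1 : ℝ) / ℓ ^ 9) := by
        field_simp
        try ring
    _ = 12 / 25 * ((20 * |c'| + 80 / π) / π) * alpha1 D := by rw [hα1]

end ResZero

/-! ## The `μ = 2` residue-sum assembly (App. B p. 107, "These together complete the proof in case μ = 2") -/

section MuTwo

variable (c' : ℝ)

/-- **The `μ = 2` evaluation assembled from its displayed steps — generic in the error rate `r`**
("These together complete the proof in case `μ = 2`", App. B p. 107, tex L5286–5309; DAG
`Z22:§B.u011` closing sentence = `Typed.AppendixB.StepB_mu2` up to the rate): from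
`StepB_u009` (`Σ_l ϰ₂(l₁l)ϱ_j(l)/l = (1/2πi)∫_{(1)} …`, a THEOREM of the tree, L4-t10), the contour
shift `StepB_u009r` in rate `r` ("the right side is equal to the sum of the residues … plus an acceptable
error"), the decomposition of `∮_{|s|=5α}` into the two small circles around `0` and `β₇` (`hsplit`),
the residue at `0` up to `O(r)` (`h10a`; the exact residue carries `1/ζ(1−β_j) = −β_j + O(α²)`, see the
FLAG on `StepB_u010a`), its evaluation `h10b` ("`= −8j/(25πi) + O(α₁)`", PROVED above for `r = α₁`),
the Cauchy formula at `β₇` (`StepB_u011a`) and its evaluation `h11b`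
("`= (1 − 2j/5 + 8j/(25πi))e^{5πi/4} + O(α₁)`"), to `Σ_l ϰ₂(l₁l)ϱ_j(l)/l = e_{2j} + O(r)`
(`e_{2j}` = `Section18Defs.e2j` = the sum of the two main values, by `ring`).
[cite: Zhang2022LandauSiegel, App. B p.107] -/
theorem stepB_mu2_rate_of (r : ℕ → ℝ) (h9 : Typed.AppendixB.StepB_u009 c')
    (h9r : ∃ C : ℝ, ForAllLarge fun D _ _ => ∀ j ∈ ({1, 2, 3} : Finset ℕ), ∀ l₁ : ℕ, 1 ≤ l₁ →
      l₁ ∈ nset (frakq D) → (l₁ : ℝ) < bigT D →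
        ‖vline 1 (intB2 c' D j l₁) -
            (2 * π * I)⁻¹ * (∮ s in C((0 : ℂ), 5 * alpha D), intB2 c' D j l₁ s)‖ ≤ C * r D)
    (hsplit : ForAllLarge fun D _ _ => ∀ j ∈ ({1, 2, 3} : Finset ℕ), ∀ l₁ : ℕ, 1 ≤ l₁ →
      (∮ s in C((0 : ℂ), 5 * alpha D), intB2 c' D j l₁ s) =
        (∮ s in C((0 : ℂ), alpha D), intB2 c' D j l₁ s) +
          ∮ s in C(beta7 D, alpha D), intB2 c' D j l₁ s)
    (h10a : ∃ C : ℝ, ForAllLarge fun D _ _ => ∀ j ∈ ({1, 2, 3} : Finset ℕ), ∀ l₁ : ℕ, 1 ≤ l₁ →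
      ‖(2 * π * I)⁻¹ * (∮ s in C((0 : ℂ), alpha D), intB2 c' D j l₁ s) - resZero2 c' D j‖ ≤ C * r D)
    (h10b : ∃ C : ℝ, ForAllLarge fun D _ _ => ∀ j ∈ ({1, 2, 3} : Finset ℕ),
      ‖resZero2 c' D j - (-(8 * (j : ℂ) / (25 * π * I)))‖ ≤ C * r D)
    (h11a : Typed.AppendixB.StepB_u011a c')
    (h11b : ∃ C : ℝ, ForAllLarge fun D _ _ => ∀ j ∈ ({1, 2, 3} : Finset ℕ), ∀ l₁ : ℕ, 1 ≤ l₁ →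
      l₁ ∈ nset (frakq D) → (l₁ : ℝ) < bigT D →
        ‖resBeta2 c' D j l₁ -
            (1 - 2 * (j : ℂ) / 5 + 8 * (j : ℂ) / (25 * π * I)) * cexp (5 * π * I / 4)‖ ≤ C * r D) :
    ∃ C : ℝ, ForAllLarge fun D _ _ => ∀ j ∈ ({1, 2, 3} : Finset ℕ), ∀ l₁ : ℕ, 1 ≤ l₁ →
      l₁ ∈ nset (frakq D) → (l₁ : ℝ) < bigT D → ‖vkSum c' D (vk2 D) j l₁ - e2j j‖ ≤ C * r D := by
  obtain ⟨C₁, g1⟩ := h9r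
  obtain ⟨C₂, g2⟩ := h10a
  obtain ⟨C₃, g3⟩ := h10b
  obtain ⟨C₄, g4⟩ := h11b
  obtain ⟨D₀, h⟩ := (((((h9.and g1).and hsplit).and g2).and g3).and h11a).and g4
  refine ⟨C₁ + C₂ + C₃ + C₄, D₀, fun D _ χ hD hq hp j hj l₁ hl₁ hn hT => ?_⟩
  obtain ⟨⟨⟨⟨⟨⟨e9, e9r⟩, esp⟩, e10a⟩, e10b⟩, e11a⟩, e11b⟩ := h D χ hD hq hp
  have a9 := e9 j hj l₁ hl₁
  have a9r := e9r j hj l₁ hl₁ hn hT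
  have asp := esp j hj l₁ hl₁
  have a10a := e10a j hj l₁ hl₁
  have a10b := e10b j hj
  have a11a := e11a j hj l₁ hl₁
  have a11b := e11b j hj l₁ hl₁ hn hT
  set V := vline 1 (intB2 c' D j l₁)
  set I5 := ∮ s in C((0 : ℂ), 5 * alpha D), intB2 c' D j l₁ s
  set I0 := ∮ s in C((0 : ℂ), alpha D), intB2 c' D j l₁ s
  set Iβ := ∮ s in C(beta7 D, alpha D), intB2 c' D j l₁ s
  set m0 : ℂ := -(8 * (j : ℂ) / (25 * π * I))
  set mβ : ℂ := (1 - 2 * (j : ℂ) / 5 + 8 * (j : ℂ) / (25 * π * I)) * cexp (5 * π * I / 4)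
  have he2j : e2j j = mβ + m0 := by simp only [e2j, mβ, m0]; ring
  have key : vkSum c' D (vk2 D) j l₁ - e2j j =
      (V - (2 * π * I)⁻¹ * I5) + ((2 * π * I)⁻¹ * I0 - resZero2 c' D j) +
        (resZero2 c' D j - m0) + (resBeta2 c' D j l₁ - mβ) := by
    rw [a9, he2j, asp, ← a11a, mul_add]; ring
  rw [key]
  calc _ ≤ ‖V - (2 * π * I)⁻¹ * I5‖ + ‖(2 * π * I)⁻¹ * I0 - resZero2 c' D j‖ +
        ‖resZero2 c' D j - m0‖ + ‖resBeta2 c' D j l₁ - mβ‖ := norm_add₄_le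
    _ ≤ C₁ * r D + C₂ * r D + C₃ * r D + C₄ * r D :=
        add_le_add (add_le_add (add_le_add a9r a10a) a10b) a11b
    _ = (C₁ + C₂ + C₃ + C₄) * r D := by ring

/-- **The `μ = 2` evaluation in the reading of record (`α₁ = α log T`)**: `StepB_mu2` with rate `α₁`
from the displayed steps with rate `α₁`, the residue-at-`0` evaluation being DISCHARGED by
`resZero2_sub_main_le`. [cite: Zhang2022LandauSiegel, App. B p.107] -/
theorem stepB_mu2_alpha1_of (h9 : Typed.AppendixB.StepB_u009 c')
    (h9r : ∃ C : ℝ, ForAllLarge fun D _ _ => ∀ j ∈ ({1, 2, 3} : Finset ℕ), ∀ l₁ : ℕ, 1 ≤ l₁ →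
      l₁ ∈ nset (frakq D) → (l₁ : ℝ) < bigT D →
        ‖vline 1 (intB2 c' D j l₁) -
            (2 * π * I)⁻¹ * (∮ s in C((0 : ℂ), 5 * alpha D), intB2 c' D j l₁ s)‖ ≤ C * alpha1 D)
    (hsplit : ForAllLarge fun D _ _ => ∀ j ∈ ({1, 2, 3} : Finset ℕ), ∀ l₁ : ℕ, 1 ≤ l₁ →
      (∮ s in C((0 : ℂ), 5 * alpha D), intB2 c' D j l₁ s) =
        (∮ s in C((0 : ℂ), alpha D), intB2 c' D j l₁ s) +
          ∮ s in C(beta7 D, alpha D), intB2 c' D j l₁ s)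
    (h10a : ∃ C : ℝ, ForAllLarge fun D _ _ => ∀ j ∈ ({1, 2, 3} : Finset ℕ), ∀ l₁ : ℕ, 1 ≤ l₁ →
      ‖(2 * π * I)⁻¹ * (∮ s in C((0 : ℂ), alpha D), intB2 c' D j l₁ s) - resZero2 c' D j‖ ≤
        C * alpha1 D)
    (h11a : Typed.AppendixB.StepB_u011a c')
    (h11b : ∃ C : ℝ, ForAllLarge fun D _ _ => ∀ j ∈ ({1, 2, 3} : Finset ℕ), ∀ l₁ : ℕ, 1 ≤ l₁ →
      l₁ ∈ nset (frakq D) → (l₁ : ℝ) < bigT D →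
        ‖resBeta2 c' D j l₁ -
            (1 - 2 * (j : ℂ) / 5 + 8 * (j : ℂ) / (25 * π * I)) * cexp (5 * π * I / 4)‖ ≤
          C * alpha1 D) :
    ∃ C : ℝ, ForAllLarge fun D _ _ => ∀ j ∈ ({1, 2, 3} : Finset ℕ), ∀ l₁ : ℕ, 1 ≤ l₁ →
      l₁ ∈ nset (frakq D) → (l₁ : ℝ) < bigT D →
        ‖vkSum c' D (vk2 D) j l₁ - e2j j‖ ≤ C * alpha1 D :=
  stepB_mu2_rate_of c' alpha1 h9 h9r hsplit h10a (resZero2_sub_main_le c') h11a h11b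

end MuTwo

end Literature.NumberTheory.LFunctions.Zhang2022.Skeleton
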